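import Summits.HodgeConjecture.HodgeConjecture.Theses.TropicalWeilObstruction
import Summits.HodgeConjecture.HodgeConjecture.Theorems.TropicalWeilObstructionTropicalWeilVanishingCalibrationCone
import Summits.HodgeConjecture.HodgeConjecture.Theorems.TropicalWeilObstructionTropicalHodgeBoundWeilClassesIndependent
import HarnessLib

/-!
# Route `TropicalWeilObstruction` (Kontsevich's tropical test — NEGATION SINK, exploration, no summit claim):
# unconditionally, the tropical Weil classes of a very general tropical Weil eightfold are NOT effective

Negation-sink bookkeeping of the cell `pub-hodge-tropical` (seat tropical-2): the one UNCONDITIONAL statement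
in the direction of the open crux K1 (`TropicalWeilVanishing`, stmt-HodgeConjecture-18478) that the landed
files give, recorded so that it is not confused with K1 itself.

On `X_Q = ℝ⁸/Qℤ⁸` with `Q ≻ 0`, `QJ = JQ`, `IsWeilGeneric 4 Q`, every effective tropical `4`-cycle `Z` has
`cyc Z = q₀ θ₄(Q) + q₁ Re w(Q) + q₂ Im w(Q)` with `q₀ ≥ 0`, `64(q₁² + q₂²) ≤ q₀²` (the calibration cone,
`effective_cyc_mem_calibrationCone`, p332805), and `θ₄(Q), Re w(Q), Im w(Q)` are linearly independent over
`ℝ` (`linearIndependent_thetaClass_weilClasses`, p335385), so the coordinates are unique. Hence: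

* `cyc_ne_of_not_mem_calibrationCone` — no effective tropical `4`-cycle has class
  `r₀ θ₄ + r₁ Re w + r₂ Im w` with `(r₀, r₁, r₂)` OUTSIDE the cone (`r₀ < 0` or `64(r₁² + r₂²) > r₀²`);
* `cyc_ne_smul_weilClassRe`, `cyc_ne_smul_weilClassIm`, `cyc_ne_weilClassRe`, `cyc_ne_weilClassIm` — in
  particular no non-zero real multiple of a tropical Weil class is the class of an effective tropical
  `4`-cycle: **the tropical Weil classes are integral Hodge classes (p334819, p335583) that are NOT
  EFFECTIVE**, unconditionally, on the very general tropical Weil eightfold.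

WHAT THIS IS NOT. The tropical Hodge conjecture [cite: Zharkov2020TropicalWeil, p. 1: "every Hodge class is
represented by an algebraic cycle"] is read, as classically, with RATIONAL COMBINATIONS of effective cycles
(differences allowed); a class outside the cone may still be a difference of two effective classes inside it.
K1 is the far stronger statement that ALL effective classes lie on the axis `ℝθ₄(Q)`
(`tropicalWeilVanishing_iff_span_cyc_le_thetaLine`), so that the Weil classes are not even in the span — that
is OPEN, and nothing here is evidence for it. Nothing here bears on the Hodge conjecture. No definition, no
named fact, no sorry.
References: [Zharkov2020TropicalWeil] I. Zharkov, arXiv:2002.02347, pp. 1–3; [MikhalkinZharkov2014Eigenwave]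
G. Mikhalkin, I. Zharkov, LN UMI 15 (2014), Prop. 4.3, Thm. 5.4.
-/

set_option linter.dupNamespace false

noncomputable section

open scoped BigOperators
open Matrix
open Literature.AlgebraicGeometry.Tropical

namespace Summit.HodgeConjecture.HodgeConjecture.Theorems.TropicalHodgeBound

/-! ## §0 Display-only notation (the K3 skeleton's local definitions, verbatim bodies; nothing is defined) -/

/-- The skeleton's `thetaClass n Q`. -/
local notation3 (prettyPrint := false) "θ⟦" n "⟧" Q:max =>
  (fun S S' : Fin n → Fin (2 * n) => Matrix.det (Matrix.submatrix Q S S'))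

/-- The skeleton's `omegaFrame n` (`Ω = Pᴴ`). -/
local notation3 (prettyPrint := false) "Ω⟦" n "⟧" =>
  (Matrix.of fun (a : Fin (2 * n)) (b : Fin n) =>
    (if (a : ℕ) = (b : ℕ) then (1 : ℂ) else 0) - (if (a : ℕ) = (b : ℕ) + n then Complex.I else 0))

/-- The skeleton's `weilClassC n Q` (`w(Q) = (⋀ⁿQ ⊗ 1)(Ω ⊗ Ω)`). -/
local notation3 (prettyPrint := false) "wC⟦" n "⟧" Q:max =>
  (fun S S' : Fin n → Fin (2 * n) =>
    Matrix.det (Matrix.submatrix (Matrix.map Q ((↑) : ℝ → ℂ) * Ω⟦n⟧) S id) *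
      Matrix.det (Matrix.submatrix (Ω⟦n⟧) S' id))

/-- The skeleton's `weilClassRe n Q` (`w₁ = Re w`). -/
local notation3 (prettyPrint := false) "wRe⟦" n "⟧" Q:max =>
  (fun S S' : Fin n → Fin (2 * n) => Complex.re ((wC⟦n⟧ Q) S S'))

/-- The skeleton's `weilClassIm n Q` (`w₂ = Im w`). -/
local notation3 (prettyPrint := false) "wIm⟦" n "⟧" Q:max =>
  (fun S S' : Fin n → Fin (2 * n) => Complex.im ((wC⟦n⟧ Q) S S'))

/-! ## §1 Uniqueness of the coordinates and the cone test -/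

section NotEffective

variable (Q : Matrix (Fin (2 * 4)) (Fin (2 * 4)) ℝ)

/-- **Coordinates on `⟨θ₄, Re w, Im w⟩` are unique** (`Q ≻ 0`, `QJ = JQ`): two real combinations that agree
as tables have the same coefficients. [cite: Zharkov2020TropicalWeil, §2] -/
theorem lincomb_coeff_unique (hQ : Q.PosDef) (hJ : Q * weilJ 4 = weilJ 4 * Q) (r s : Fin 3 → ℝ)
    (h : r 0 • θ⟦4⟧ Q + r 1 • wRe⟦4⟧ Q + r 2 • wIm⟦4⟧ Q =
      s 0 • θ⟦4⟧ Q + s 1 • wRe⟦4⟧ Q + s 2 • wIm⟦4⟧ Q) : r = s := by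
  have hli := linearIndependent_thetaClass_weilClasses (by norm_num : 0 < 4) Q hQ hJ
  rw [Fintype.linearIndependent_iff] at hli
  have h0 : ∑ i : Fin 3, (r i - s i) • (![θ⟦4⟧ Q, wRe⟦4⟧ Q, wIm⟦4⟧ Q] i) = 0 := by
    simp only [Fin.sum_univ_three, Matrix.cons_val_zero, Matrix.cons_val_one, Matrix.cons_val_two,
      Matrix.tail_cons, Matrix.head_cons, sub_smul]
    rw [sub_add_sub_comm, sub_add_sub_comm, sub_eq_zero]
    exact h
  funext i
  exact sub_eq_zero.mp (hli (fun i => r i - s i) h0 i)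

/-- **No effective class outside the calibration cone.** On a very general tropical Weil eightfold
(`Q ≻ 0`, `QJ = JQ`, `IsWeilGeneric 4 Q`) no effective tropical `4`-cycle has class `r₀ θ₄ + r₁ Re w + r₂ Im w`
with `r₀ < 0` or `r₀² < 64 (r₁² + r₂²)`. [cite: Zharkov2020TropicalWeil, §2] -/
theorem cyc_ne_of_not_mem_calibrationCone (hQ : Q.PosDef) (hJ : Q * weilJ 4 = weilJ 4 * Q)
    (hgen : IsWeilGeneric 4 Q) (Z : TropicalTorusCycle (2 * 4) 4 Q) (r : Fin 3 → ℝ)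
    (hr : r 0 < 0 ∨ (r 0) ^ 2 < 64 * ((r 1) ^ 2 + (r 2) ^ 2)) :
    TropicalTorusCycle.cyc Z ≠ r 0 • θ⟦4⟧ Q + r 1 • wRe⟦4⟧ Q + r 2 • wIm⟦4⟧ Q := by
  intro h
  obtain ⟨q, hq, hq0, hcone⟩ := TropicalWeilVanishing.effective_cyc_mem_calibrationCone Q hQ hJ hgen Z
  rw [hq] at h
  have e := lincomb_coeff_unique Q hQ hJ (fun i => ((q i : ℚ) : ℝ)) r h
  have e0 : ((q 0 : ℚ) : ℝ) = r 0 := congrFun e 0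
  have e1 : ((q 1 : ℚ) : ℝ) = r 1 := congrFun e 1
  have e2 : ((q 2 : ℚ) : ℝ) = r 2 := congrFun e 2
  have hq0' : (0 : ℝ) ≤ ((q 0 : ℚ) : ℝ) := by exact_mod_cast hq0
  have hcone' : (64 : ℝ) * (((q 1 : ℚ) : ℝ) ^ 2 + ((q 2 : ℚ) : ℝ) ^ 2) ≤ ((q 0 : ℚ) : ℝ) ^ 2 := by
    exact_mod_cast hcone
  rw [e0, e1, e2] at hcone'
  rw [e0] at hq0'
  rcases hr with hr | hr
  · exact absurd hr (not_lt.mpr hq0')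
  · exact absurd hr (not_lt.mpr hcone')

/-- **No non-zero multiple of `Re w(Q)` is effective** on a very general tropical Weil eightfold.
[cite: Zharkov2020TropicalWeil, pp. 1–2] -/
theorem cyc_ne_smul_weilClassRe (hQ : Q.PosDef) (hJ : Q * weilJ 4 = weilJ 4 * Q)
    (hgen : IsWeilGeneric 4 Q) (Z : TropicalTorusCycle (2 * 4) 4 Q) (c : ℝ) (hc : c ≠ 0) :
    TropicalTorusCycle.cyc Z ≠ c • wRe⟦4⟧ Q := by
  have h := cyc_ne_of_not_mem_calibrationCone Q hQ hJ hgen Z ![0, c, 0]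
    (Or.inr (by simp; positivity))
  simpa using h

/-- **No non-zero multiple of `Im w(Q)` is effective** on a very general tropical Weil eightfold.
[cite: Zharkov2020TropicalWeil, pp. 1–2] -/
theorem cyc_ne_smul_weilClassIm (hQ : Q.PosDef) (hJ : Q * weilJ 4 = weilJ 4 * Q)
    (hgen : IsWeilGeneric 4 Q) (Z : TropicalTorusCycle (2 * 4) 4 Q) (c : ℝ) (hc : c ≠ 0) :
    TropicalTorusCycle.cyc Z ≠ c • wIm⟦4⟧ Q := by
  have h := cyc_ne_of_not_mem_calibrationCone Q hQ hJ hgen Z ![0, 0, c]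
    (Or.inr (by simp; positivity))
  simpa using h

/-- **The tropical Weil class `Re w(Q)` is not effective** (an integral Hodge class — p334819, p335583 —
which is the class of no effective tropical `4`-cycle) on a very general tropical Weil eightfold. This is NOT
the failure of the tropical Hodge conjecture there (that is the open K1: all effective classes on the theta
line). [cite: Zharkov2020TropicalWeil, pp. 1–2] -/
theorem cyc_ne_weilClassRe (hQ : Q.PosDef) (hJ : Q * weilJ 4 = weilJ 4 * Q) (hgen : IsWeilGeneric 4 Q)
    (Z : TropicalTorusCycle (2 * 4) 4 Q) : TropicalTorusCycle.cyc Z ≠ wRe⟦4⟧ Q := by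
  simpa using cyc_ne_smul_weilClassRe Q hQ hJ hgen Z 1 one_ne_zero

/-- **The tropical Weil class `Im w(Q)` is not effective** on a very general tropical Weil eightfold.
[cite: Zharkov2020TropicalWeil, pp. 1–2] -/
theorem cyc_ne_weilClassIm (hQ : Q.PosDef) (hJ : Q * weilJ 4 = weilJ 4 * Q) (hgen : IsWeilGeneric 4 Q)
    (Z : TropicalTorusCycle (2 * 4) 4 Q) : TropicalTorusCycle.cyc Z ≠ wIm⟦4⟧ Q := by
  simpa using cyc_ne_smul_weilClassIm Q hQ hJ hgen Z 1 one_ne_zero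

end NotEffective

end Summit.HodgeConjecture.HodgeConjecture.Theorems.TropicalHodgeBound

end
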